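import Summits.Ventures.Crystal3D.Theorems.StickyWulffConstantTextureBuildMesh
import Summits.Ventures.Crystal3D.Theorems.StickyWulffConstantTextureBuildCrustLine
import HarnessLib

/-!
# TB-1: the CERTIFIED CELL COVER with CRUST CELLS (interface v2) — the tiling identity with crusts and the level-2 composition of record
# (lane T, crux `TextureLiminfV5`, stmt-Ventures-23912; `stub_textureBuild` → TB-0.md §7/§8; cf-p1 DECISION (cxxv) «register only on Mesh v2 (CrustCell, §73.8)»)

HONEST FRAMING. Venture `Summits/Ventures/Crystal3D` (cell `crystal3d-full`), route `route-Ventures-StickyWulffConstant`, helper `--supports` the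
law-v5 crux `TextureLiminfV5` (stmt-Ventures-23912).  One DEFINITION (the crusted cover) + pure finite combinatorics and logic (census-free, standard axioms).
No cover is constructed, no texture is built, no adhesion law is proved — each crust cell CARRIES its T-form adhesion inequality as a field; rung F-C1 not moved.

* `CrustedCover C R₀ N x` EXTENDS `CellCover` (…TextureBuildCellCover) by finitely many CRUST CELLS `c`, each attached to a tent piece `tf c`: host lattice balls
  `cP c ⊆ owned (tf c)`, crust balls `cB c ⊆ X′ ∖ Xh` (OWNED by the crust cell, disjoint from every other owner), phantom sites `cQ c ⊆ Xh ∖ X′` (the continuation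
  fed to the tent, §73.8), the law's rim `cA c`, and THE T-FORM ADHESION INEQUALITY `hadh : cross(P,B) ≤ D(B) + (cross(P,Q) − D(Q)) + A` (TB-0.md §8: plate :=
  ALL lattice balls; the slab form of `stub_barlowAdhesionR` does not close the books).
* `tentRimSharp`, `crustTerm`, `crustRim`, **`tilingLoss₂ := Σ_f tentRimSharp f − Σ_c crustTerm c + Σ_c crustRim c + Σ_k tilingRim k`** — an explicit real
  expression (what TB-B must make `≤ θ·N^{2/3}` together with `rimSum` and the mesh's `gapCost`).
* **`CrustedCover.tiling₂`**: `tentBudget + cellBudget ≤ (6N′ − C(x′)) + tilingLoss₂` — from the SHARP tent line, the wall-cell line, the CRUST LINE and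
  `Σ_{owned} halfDefect ≤ D(X′)` over the pairwise disjoint owners (tents' owned balls, crust balls, cells' balls).
* **`shadowTheoremSatAtomicV5_of_crusted`** — THE LEVEL-2 COMPOSITION OF RECORD (v8.5): «TB-cover» produces a crusted cover AND a mesh of its underlying cover with
  `tilingLoss₂ + rimSum + gapCost ≤ θ·N^{2/3}`; «TB-energy» is UNCHANGED (binder shape over `(cv : CellCover) (μ : Mesh cv δ)`: crusts add no texture); with the
  wall law they give `ShadowTheoremSatAtomicV5`.
WHAT THIS IS NOT: no cover is exhibited; F-C1 not moved.
-/

noncomputable section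

open scoped BigOperators InnerProductSpace ENNReal
open MeasureTheory

namespace Summit.Ventures.Crystal3D.Cruxes.TextureLiminf.TexShadow

open Summit.Ventures.Crystal3D Summit.Ventures.Crystal3D.Theorems Finset
open Literature.MathematicalPhysics.StatisticalMechanics (IsHaggSeq fccStacking barlowStacking contactDeficiency)

/-- **CERTIFIED CELL COVER WITH CRUST CELLS** (interface v2). -/
structure CrustedCover (C R₀ : ℝ) (N : ℕ) (x : Fin N → E3) extends CellCover C R₀ N x where
  /-- crust cells, each attached to a tent piece -/
  nc : ℕ
  tf : Fin nc → Fin ng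
  /-- host lattice balls, crust balls, phantom sites, the law's rim -/
  cP : Fin nc → Finset E3
  cB : Fin nc → Finset E3
  cQ : Fin nc → Finset E3
  cA : Fin nc → ℝ
  hcP : ∀ c, cP c ⊆ (tent (tf c)).owned (Finset.univ.image x')
  hcB : ∀ c, cB c ⊆ Finset.univ.image x' \ (tent (tf c)).Xh
  hcQ : ∀ c, cQ c ⊆ (tent (tf c)).Xh \ Finset.univ.image x'
  /-- THE T-FORM ADHESION INEQUALITY of the crust cell (TB-0.md §8) -/
  hadh : ∀ c, (crossCount (cP c) (cB c) : ℝ) ≤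
    contactDeficiency (cB c) + ((crossCount (cP c) (cQ c) : ℝ) - contactDeficiency (cQ c)) + cA c
  /-- crust balls are owned by their cell only -/
  hBB : ∀ c c', c ≠ c' → Disjoint (cB c) (cB c')
  hBT : ∀ c f, Disjoint (cB c) ((tent f).owned (Finset.univ.image x'))
  hBC : ∀ c k, Disjoint (cB c) (cell k).act

namespace CrustedCover

variable {C R₀ : ℝ} {N : ℕ} {x : Fin N → E3}

open scoped Classical in
/-- the SHARP rim of tent piece `f`: half its owned balls' off-tent bonds, minus half their phantom-neighbour credit, plus half the near-`U` phantoms' vacant counts -/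
def tentRimSharp (cc : CrustedCover C R₀ N x) (f : Fin cc.ng) : ℝ :=
  (crossCount ((cc.tent f).owned cc.X') (cc.X' \ (cc.tent f).Xh) : ℝ) / 2 -
    (crossCount ((cc.tent f).owned cc.X') ((cc.tent f).Xh \ cc.X') : ℝ) / 2 +
    (∑ a ∈ ((cc.tent f).Xh \ cc.X').filter (fun a => Metric.infDist a (cc.tent f).U ≤ Real.sqrt 2), ((12 : ℝ) - (cdeg (cc.tent f).Xh a : ℝ))) / 2

/-- what crust cell `c` takes over from its tent's rim (half of the crust line's left side) -/
def crustTerm (cc : CrustedCover C R₀ N x) (c : Fin cc.nc) : ℝ :=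
  ((∑ q ∈ cc.cQ c, ((12 : ℝ) - (cdeg (cc.tent (cc.tf c)).Xh q : ℝ))) - (crossCount (cc.cP c) (cc.cQ c) : ℝ) +
    (crossCount (cc.cP c) (cc.cB c) : ℝ)) / 2

/-- the crust cell's own rim: half the crust's bonds leaving the cell plus the law's rim -/
def crustRim (cc : CrustedCover C R₀ N x) (c : Fin cc.nc) : ℝ :=
  (crossCount (cc.cB c) (cc.X' \ (cc.cB c ∪ cc.cP c)) : ℝ) / 2 + cc.cA c

/-- **the TILING LOSS with crusts** (explicit; TB-B's job is to make it small) -/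
def tilingLoss₂ (cc : CrustedCover C R₀ N x) : ℝ :=
  ∑ f, cc.tentRimSharp f - ∑ c, cc.crustTerm c + ∑ c, cc.crustRim c + ∑ k, (cc.cell k).tilingRim

/-- the crust line, per crust cell: `crustTerm ≤ Σ_{crust balls} halfDefect + crustRim` -/
theorem crustTerm_le (cc : CrustedCover C R₀ N x) (c : Fin cc.nc) :
    cc.crustTerm c ≤ ∑ b ∈ cc.cB c, halfDefect cc.X' b + cc.crustRim c := by
  have hPowned := cc.hcP c
  have hPXh : cc.cP c ⊆ (cc.tent (cc.tf c)).Xh := fun p hp => by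
    have := hPowned hp
    unfold TentPiece.owned at this
    classical
    exact (Finset.mem_inter.1 (Finset.mem_filter.1 this).1).1
  have hPX' : cc.cP c ⊆ cc.X' := fun p hp => (cc.tent (cc.tf c)).owned_subset cc.X' (hPowned hp)
  have h := crustLine hPXh hPX' (cc.hcB c) (cc.hcQ c) (cc.hadh c)
  unfold crustTerm crustRim
  unfold CellCover.X' at h ⊢
  linarith

/-- the sharp tent line, per tent piece: `budget ≤ Σ_{owned} halfDefect + tentRimSharp` -/
theorem tentBudget_le_sharp (cc : CrustedCover C R₀ N x) (f : Fin cc.ng) :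
    (cc.tent f).budget ≤ ∑ a ∈ (cc.tent f).owned cc.X', halfDefect cc.X' a + cc.tentRimSharp f := by
  classical
  have h := brokenNearIn_le_sum_halfDefect_sharp (cc.tent f).hσ (cc.tent f).hXh cc.X' (cc.tent f).U
  have h2 : ∑ a ∈ ((cc.tent f).Xh ∩ cc.X').filter (fun a => Metric.infDist a (cc.tent f).U ≤ Real.sqrt 2), 2 * halfDefect cc.X' a =
      2 * ∑ a ∈ ((cc.tent f).Xh ∩ cc.X').filter (fun a => Metric.infDist a (cc.tent f).U ≤ Real.sqrt 2), halfDefect cc.X' a := by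
    rw [Finset.mul_sum]
  rw [h2] at h
  unfold TentPiece.budget tentRimSharp TentPiece.owned
  linarith

/-- **THE TILING IDENTITY WITH CRUSTS** (`R₀ ≥ 1`): `tentBudget + cellBudget ≤ (6N′ − C(x′)) + tilingLoss₂`. -/
theorem tiling₂ (cc : CrustedCover C R₀ N x) (hR₀ : 1 ≤ R₀) :
    cc.tentBudget + cc.cellBudget ≤ (6 * (cc.N' : ℝ) - (numContacts cc.x' : ℝ)) + cc.tilingLoss₂ := by
  classical
  -- owners: tents' owned balls, crust balls, cells' balls
  set own : (Fin cc.ng ⊕ Fin cc.nc) ⊕ Fin cc.nk → Finset E3 := fun i =>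
    match i with
    | Sum.inl (Sum.inl f) => (cc.tent f).owned cc.X'
    | Sum.inl (Sum.inr c) => cc.cB c
    | Sum.inr k => (cc.cell k).act with hown
  have hsub : ∀ i ∈ (Finset.univ : Finset ((Fin cc.ng ⊕ Fin cc.nc) ⊕ Fin cc.nk)), own i ⊆ cc.X' := by
    rintro ((f | c) | k) -
    · exact (cc.tent f).owned_subset cc.X'
    · exact fun b hb => (Finset.mem_sdiff.1 (cc.hcB c hb)).1
    · exact (cc.cell k).act_subset
  have hdisj : ∀ i ∈ (Finset.univ : Finset ((Fin cc.ng ⊕ Fin cc.nc) ⊕ Fin cc.nk)),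
      ∀ j ∈ (Finset.univ : Finset ((Fin cc.ng ⊕ Fin cc.nc) ⊕ Fin cc.nk)), i ≠ j → Disjoint (own i) (own j) := by
    rintro ((f | c) | k) - ((g | c') | l) - hne
    · exact cc.hdisjTT f g (fun h => hne (by rw [h]))
    · exact (cc.hBT c' f).symm
    · exact cc.hdisjTC f l
    · exact cc.hBT c g
    · exact cc.hBB c c' (fun h => hne (by rw [h]))
    · exact cc.hBC c l
    · exact (cc.hdisjTC g k).symm
    · exact (cc.hBC c' k).symm
    · exact cc.hdisjCC k l (fun h => hne (by rw [h]))
  have hhd : ∑ i, ∑ a ∈ own i, halfDefect cc.X' a ≤ contactDeficiency cc.X' := by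
    rw [← Finset.sum_biUnion hdisj]
    exact sum_halfDefect_le_contactDeficiency cc.X' cc.X'_sep (Finset.biUnion_subset.2 hsub)
  rw [Fintype.sum_sum_type, Fintype.sum_sum_type] at hhd
  -- per-piece lines
  have htent : cc.tentBudget ≤ ∑ f, ∑ a ∈ (cc.tent f).owned cc.X', halfDefect cc.X' a + ∑ f, cc.tentRimSharp f := by
    unfold CellCover.tentBudget
    rw [← Finset.sum_add_distrib]
    exact Finset.sum_le_sum fun f _ => cc.tentBudget_le_sharp f
  have hcell : cc.cellBudget ≤ ∑ k, ∑ a ∈ (cc.cell k).act, halfDefect cc.X' a + ∑ k, (cc.cell k).tilingRim := by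
    unfold CellCover.cellBudget
    rw [← Finset.sum_add_distrib]
    exact Finset.sum_le_sum fun k _ => (cc.cell k).budget_le hR₀
  have hcrust : ∑ c, cc.crustTerm c ≤ ∑ c, ∑ b ∈ cc.cB c, halfDefect cc.X' b + ∑ c, cc.crustRim c := by
    rw [← Finset.sum_add_distrib]
    exact Finset.sum_le_sum fun c _ => cc.crustTerm_le c
  rw [← cc.contactDeficiency_X']
  unfold tilingLoss₂
  have hown₁ : ∑ f, ∑ a ∈ own (Sum.inl (Sum.inl f)), halfDefect cc.X' a = ∑ f, ∑ a ∈ (cc.tent f).owned cc.X', halfDefect cc.X' a := rfl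
  have hown₂ : ∑ c, ∑ a ∈ own (Sum.inl (Sum.inr c)), halfDefect cc.X' a = ∑ c, ∑ b ∈ cc.cB c, halfDefect cc.X' b := rfl
  have hown₃ : ∑ k, ∑ a ∈ own (Sum.inr k), halfDefect cc.X' a = ∑ k, ∑ a ∈ (cc.cell k).act, halfDefect cc.X' a := rfl
  linarith

/-- **The discrete half with crusts**: `tentBudget + chargeSum ≤ (6N − C(x)) + tilingLoss₂ + rimSum` (wall law at `(C, R₀)`, `R₀ ≥ 1`). -/
theorem tentBudget_add_chargeSum_le₂ (cc : CrustedCover C R₀ N x) (hR₀ : 1 ≤ R₀)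
    (hW : ∀ (σ₁ σ₂ : ℤ → ℤ), IsHaggSeq σ₁ → IsHaggSeq σ₂ →
      ∀ (L₁ L₂ : E3 ≃ₗᵢ[ℝ] E3) (s₁ s₂ : E3) (A₁ A₂ : ℤ → (E3 ≃ₗᵢ[ℝ] E3)),
      (∀ i, ∃ u : E3, bilayer L₁ s₁ σ₁ i ⊆ (fun r => A₁ i r + u) '' fccRef) →
      (∀ j, ∃ u : E3, bilayer L₂ s₂ σ₂ j ⊆ (fun r => A₂ j r + u) '' fccRef) →
      ∀ (c : ℤ → ℤ → ℝ) (m : ℤ → ℤ → E3), (∀ i j, 0 ≤ c i j) → (∀ i j, c i j ≤ 13 / 25) →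
      (∀ i j, CoAx (A₁ i) (A₂ j) → A₁ i '' fccRef ≠ A₂ j '' fccRef →
        SharedAxis (m i j) (A₁ i) (A₂ j) ∧ c i j ≤ 1 / 2 * Real.sqrt (1 - ⟪m i j, e₃⟫_ℝ ^ 2)) →
      (∀ i j, A₁ i '' fccRef = A₂ j '' fccRef → c i j = 0) →
      BilayerWallAt C R₀ σ₁ σ₂ L₁ L₂ s₁ s₂ c) :
    cc.tentBudget + cc.chargeSum ≤ (6 * (N : ℝ) - (numContacts x : ℝ)) + cc.tilingLoss₂ + cc.rimSum := by
  have h1 := cc.tiling₂ hR₀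
  have h2 := cc.chargeSum_le hW
  have h3 := cc.hDef
  linarith

end CrustedCover

/-! ## The level-2 composition of record (v8.5) -/

/-- **THE LEVEL-2 COMPOSITION over crusted cover + mesh** (cf-p1 (cxxv)): «TB-cover» (crusted cover AND a mesh of its underlying cover, with
`tilingLoss₂ + rimSum + gapCost ≤ θ·N^{2/3}`) + «TB-energy» (UNCHANGED binder shape: cover + mesh ⇒ texture) + the wall law ⇒ `ShadowTheoremSatAtomicV5`. -/
theorem shadowTheoremSatAtomicV5_of_crusted
    (hcover : BarlowResolution → BarlowAdhesionR →
      ∀ C R₀ : ℝ, 1 ≤ R₀ → ∀ K δ θ : ℝ, 0 < δ → 0 < θ → ∃ N₀ : ℕ, ∀ N : ℕ, N₀ ≤ N → ∀ x : Fin N → E3, IsUnitPacking x →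
        IsSaturated x → 6 * (N : ℝ) - (numContacts x : ℝ) ≤ K * (N : ℝ) ^ ((2 : ℝ) / 3) →
        ∃ (cc : CrustedCover C R₀ N x) (μ : Mesh cc.toCellCover δ),
          cc.tilingLoss₂ + cc.rimSum + μ.gapCost ≤ θ * (N : ℝ) ^ ((2 : ℝ) / 3))
    (henergy : PolytopeCalculus → BarlowFreeCertificate →
      ∀ (C R₀ : ℝ) (N : ℕ) (x : Fin N → E3) (δ : ℝ) (cv : CellCover C R₀ N x) (μ : Mesh cv δ),
        ∃ (n : ℕ) (G : Fin n → Set E3) (A : Fin n → (E3 ≃ₗᵢ[ℝ] E3)) (c : Fin n → Fin n → ℝ) (m : Fin n → Fin n → E3),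
          IsTexture (13 / 25) (1 / 2) n G A c m ∧ (1 - δ) * (N : ℝ) ≤ Real.sqrt 2 * vol n G ∧
          energy n G A c m ≤ cv.tentBudget + cv.chargeSum + μ.gapCost) :
    BarlowResolution → BarlowAdhesionR → BilayerWallV5 → PolytopeCalculus → BarlowFreeCertificate →
      ShadowTheoremSatAtomicV5 := by
  intro hres hadh hBW hpoly hfree _hG _hC _hNRG _hSL K δ θ hδ hθ
  obtain ⟨C, R₀, hR₀, hW⟩ := hBW
  obtain ⟨N₀, hN₀⟩ := hcover hres hadh C R₀ hR₀ K δ θ hδ hθ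
  refine ⟨N₀, fun N hN x hx hsat hK => ?_⟩
  obtain ⟨cc, μ, hslack⟩ := hN₀ N hN x hx hsat hK
  obtain ⟨n, G, A, c, m, hT, hvol, hEn⟩ := henergy hpoly hfree C R₀ N x δ cc.toCellCover μ
  refine ⟨n, G, A, c, m, hT, hvol, ?_⟩
  have hdisc := cc.tentBudget_add_chargeSum_le₂ hR₀ hW
  have htb : cc.toCellCover.tentBudget = cc.tentBudget := rfl
  have hcs : cc.toCellCover.chargeSum = cc.chargeSum := rfl
  rw [htb, hcs] at hEn
  linarith

end Summit.Ventures.Crystal3D.Cruxes.TextureLiminf.TexShadow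

end
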